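import Summits.QuantumFields.BalabanUV.T4Continuum.Spine.NE3.SupRegularityLocalGauge
import Summits.QuantumFields.BalabanUV.T4Continuum.Spine.NE3.LandauCorrectionSupB8Flat
import Summits.QuantumFields.BalabanUV.T4Continuum.Support.NE3RightInverseSupLetters
import Summits.QuantumFields.BalabanUV.T4Continuum.Support.BlockAverageCurrent
import HarnessLib

/-!
# T⁴ programme, node NE3 — census R39 (file 2): THE END's SUP LETTER `hK` AT A CURVED BACKGROUND OF THE CLASS FROM THE LOCAL-GAUGE SHAPE AND (HR_W) — the
# covariant sup block-mean bound on `N(Q′(W))` is PROVED (curved (‡) + the frame-potential sup letter), so (H0_W) ⇐ local gauges alone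

Cell `pub-balaban-gaps` (YM blitz, track G2, seat `ne3`, unit `pub-balaban-gaps-ne3-g8`; writer prover-pub-balaban-gaps-ne3-g8-0, 2026-08-24), census
`run/shared/lean/pub/pub-balaban-gaps/ne/NE3.md` §4 R39, §14.  File 1 (`SupRegularityLocalGauge`) reduced the curved (H0_W) to a LOCAL GAUGE SHAPE plus the covariant sup block-mean
SHAPE `‖u‖_∞ ≤ C_U‖D_Wu‖_∞`.  THIS FILE:
* §1 **`norm_le_of_mem_avgKernelGauges`** — the covariant sup block-mean bound IS KINEMATIC in the multi-level small-field class: for `u ∈ N(Q′(W)) = avgKernelGauges L N (j+1) W`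
  with `‖D_Wu‖_∞ ≤ G`, `‖u(y)‖ ≤ (frameC d L + d)·M·G` (`M = L^{j+1}`): the curved identity (‡) `framePotW (gaugeDir W u) z = u(M•z) − bmeanIterW u z`
  (`NE3CovariantBlockMean.framePotW_gaugeDir`) with `bmeanIterW u = 0`, the frame-potential sup letter `‖framePotW Y‖ ≤ frameC·M·‖Y‖_∞`
  (`NE3RightInverseSupLetters.norm_framePotW_le_of_sup`), and covariant `ℓ¹`-paths inside the block (`‖u(x+e_ν)‖ ≤ ‖u x‖ + ‖D_Wu(x,ν)‖`, unitary transport).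
* §2 **`supRegularity_of_localGauge_class`** — (H0_W) in the class ⇐ the local-gauge SHAPE at radius `R = r·M` and ONE line:
  `‖D_Wu‖_∞ ≤ 4rM·‖Δ_Wu‖_∞`, `‖u‖_∞ ≤ 4(frameC + d)r·M²·‖Δ_Wu‖_∞`.
* §3 **`landauCorrectionSupB8_of_localGauge`** — gen 7's `landauCorrectionSupB8_of_supFacts` with (H0_W) so supplied: THE END's per-pair `hK` at a curved background `W`
  ⇐ the local-gauge SHAPE ∧ (HR_W) ∧ the line (`c₀ = 4(frameC d L + d)R∕M`, `c₁ = 4R∕M`).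
* §4 **`supRegularity_of_axialDivergence`** — the `a`-half of the local-gauge shape IS IN THE TREE: the AXIAL (comb) gauge `axialFn W (y₀ − (R+1)𝟙)` of
  [Balaban1985Averaging] pp. 24–25 has `‖W^u(z,ν) − 1‖ ≤ |lowPart_ν(z − base)|₁·x ≤ 2d(R+1)·x` on the cube (`B8Lemma1NonAbelian.axial_bond_bound_sharp`, as in
  `BlockAverageCurrent.exists_nearId_gauge`); so (H0_W) in the class ⇐ ONE displayed fact about `W`: the AXIAL-GAUGE DIVERGENCE bound `‖Σ_ν(E(y,ν) − E(y−e_ν,ν))‖ ≤ δ`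
  on every cube of radius `R` (`E = W^{axialFn W (y₀−(R+1)𝟙)} − 1`) ∧ the line with `a = 2d(R+1)x`; **`landauCorrectionSupB8_of_axialDivergence`**: THE END's `hK(W)` ⇐ that
  fact ∧ (HR_W).

WHERE THE LOCAL-GAUGE SHAPE COMES FROM (census R39, NOT here): the comb gauge (`NE3CombGauge`: `a ≍ dR·x`) and its divergence, a sum of ≤ `R` covariant FLUX GRADIENTS along the comb
strips (`δ ≍ dR·x₁ + R²x²` from the flux-gradient regularity `x₁ ≍ x∕M` of [B8] (1.34) ∕ [B11] Thm 1 (10) TYPE); with `R = rM` the line reads `M²x`, `M³x₁` small, k-free.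

CONTENT (0 sorry; no `def`; [folklore]).  HONEST FRAMING.  §1 is an unconditional kinematic fact; §2∕§3 are CONDITIONAL reductions (the local-gauge shape and (HR_W) are NOT
discharged here for any curved background); `hK`∕(P♮) at curved `W`, `PairLandauGaugeB8Avg`, the covariant root and **NE3 are NOT proved**; spine PROVED 0∕9; finite T⁴ rung (B)+1 —
NOT infinite volume, NOT mass gap, NOT `BetaPertH`, NOT Clay.  PLACEMENT: `Summits/QuantumFields/BalabanUV/T4Continuum/Spine/NE3/`; imports accepted modules only.
-/

set_option autoImplicit false

open scoped BigOperators Matrix Matrix.Norms.L2Operator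
open NormedSpace Finset

namespace Summit.QuantumFields.BalabanUV.T4Continuum.NE3.LandauCorrectionSupB8LocalGauge

open Literature.MathematicalPhysics.QuantumFieldTheory.Balaban1983to89
open B7Prop1Explicit B7Prop2Explicit MatrixNorms
open T4AveragingDeficitWall (Ad IsUnitaryCfg IsSkewDir SmallField)
open T4AveragingDeficitWallBoundary (IsPeriodicCfg periodBox mem_periodBox)
open AveragingDeficitMultiLevelPrep (tower LevelSmall)
open AveragingDeficitTransport (norm_Ad_of_unitary)
open BlockAveragePushDirGauge (gaugeDir)
open SkeletonLattice (cdiv cmod smul_cdiv_add_cmod cmod_nonneg cmod_lt)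
open NE3QbarIterCovLiftPrep (cruxC liftC)
open NE3CovariantCalculus (hsR)
open NE3TangentCovariantTower (framePotW)
open NE3CovariantBlockMean (bmeanIterW framePotW_gaugeDir)
open NE3RightInverseSupLetters (frameC norm_framePotW_le_of_sup)
open NE3FramePotBoundW (tower_eq_pow_mul)
open NE3DiscreteGradientEstimate (lipschitz_of_forwardDiff)
open NE3.PairLandauB8 (avgKernelGauges covLapSite)
open NE3.LandauProjectionSupShape (LandauCorrectionSupB8)
open NE3.LandauCorrectionSupB8Flat (landauCorrectionSupB8_of_supFacts)
open NE3.SupRegularityLocalGauge (supRegularity_of_localGauge)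
open B8Lemma1NonAbelian (PlaqSmall lowPart axial_bond_bound_sharp)
open B8Ineq129 (l1_lowPart_le)
open AveragingDeficitTransport (mem_U1_of_unitary)

noncomputable section

variable {d : ℕ} {n : Type*} [Fintype n] [DecidableEq n]

/-! ## §1 The covariant sup block-mean bound on `N(Q′(W))` -/

/-- Covariant paths: `|‖u(x + m)‖ − ‖u x‖| ≤ ‖D_Wu‖_∞·Σ_i|m_i|` for a unitary background (`‖u(x+e_ν)‖` and `‖u x‖` differ by at most `‖D_Wu(x,ν)‖`). [folklore] -/
theorem abs_norm_sub_norm_le [Nonempty n] {W : Site d → Fin d → (Matrix n n ℂ)ˣ} (hWu : IsUnitaryCfg W) (u : Site d → (Matrix n n ℂ)) {G : ℝ}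
    (hG : ∀ (x : Site d) (μ : Fin d), ‖gaugeDir W u x μ‖ ≤ G) (x m : Site d) :
    |‖u (x + m)‖ - ‖u x‖| ≤ G * ∑ i, ((|m i| : ℤ) : ℝ) := by
  have hstep : ∀ (y : Site d) (i : Fin d), ‖‖u (y + e i)‖ - ‖u y‖‖ ≤ G := by
    intro y i
    have hAd : Ad (W y i)⁻¹ (u y) = u (y + e i) + gaugeDir W u y i := by simp only [gaugeDir]; abel
    have hn : ‖Ad (W y i)⁻¹ (u y)‖ = ‖u y‖ := norm_Ad_of_unitary ((unitaryUnits (Matrix n n ℂ)).inv_mem (hWu y i)) _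
    have h2 : ‖u y‖ ≤ ‖u (y + e i)‖ + G := by
      rw [← hn, hAd]; exact (norm_add_le _ _).trans (by linarith [hG y i])
    have h3 : ‖u (y + e i)‖ ≤ ‖u y‖ + G := by
      have h4 : u (y + e i) = Ad (W y i)⁻¹ (u y) - gaugeDir W u y i := by rw [hAd]; abel
      rw [h4]; exact (norm_sub_le _ _).trans (by rw [hn]; linarith [hG y i])
    rw [Real.norm_eq_abs, abs_le]
    constructor <;> linarith
  have h := lipschitz_of_forwardDiff (E := ℝ) (fun y => ‖u y‖) hstep x m
  rwa [Real.norm_eq_abs] at h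

/-- **THE COVARIANT SUP BLOCK-MEAN BOUND ON `N(Q′(W))`** (multi-level small-field class at level `j`, `M = L^{j+1}`, period `N·M`, `d ≥ 1`): for
`u ∈ avgKernelGauges L N (j+1) W` with `‖D_Wu(x,μ)‖ ≤ G` everywhere, `‖u(y)‖ ≤ (frameC d L + d)·M·G` at every site — the curved identity (‡) puts `u` at the block
corners equal to the frame potential of `D_Wu` (`≤ frameC·M·G`), and covariant paths inside the block add at most `d·M·G`. [folklore] -/
theorem norm_le_of_mem_avgKernelGauges [Nonempty n] (hd : 1 ≤ d) {L N : ℕ} [NeZero N] (hL : 2 ≤ L) (j : ℕ)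
    {W : Site d → Fin d → (Matrix n n ℂ)ˣ} {x : ℝ} (hWu : IsUnitaryCfg W) (hWP : IsPeriodicCfg W ((N * L ^ (j + 1) : ℕ) : ℤ))
    (hx : 0 ≤ x) (hs : LevelSmall d L j x) (hWx : SmallField W x)
    {u : Site d → (Matrix n n ℂ)} (hu : u ∈ avgKernelGauges (d := d) (n := n) L N (j + 1) W)
    {G : ℝ} (hG : ∀ (y : Site d) (μ : Fin d), ‖gaugeDir W u y μ‖ ≤ G) (y : Site d) :
    ‖u y‖ ≤ (frameC d L + d) * (L : ℝ) ^ (j + 1) * G := by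
  have hL1 : 1 ≤ L := by omega
  set M : ℕ := L ^ (j + 1) with hM_def
  have hM : 1 ≤ M := Nat.one_le_pow _ _ hL1
  have hMr : (M : ℝ) = (L : ℝ) ^ (j + 1) := by rw [hM_def]; push_cast; ring
  have hMz : ((M : ℕ) : ℤ) = (L : ℤ) ^ (j + 1) := by rw [hM_def]; push_cast; ring
  have hG0 : 0 ≤ G := (norm_nonneg _).trans (hG 0 ⟨0, hd⟩)
  obtain ⟨hus, huP, hmean⟩ := hu
  -- periodicity in `tower` form
  have htow : ((tower L N (j + 1) : ℕ) : ℤ) = ((N * L ^ (j + 1) : ℕ) : ℤ) := by rw [tower_eq_pow_mul, Nat.mul_comm]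
  have hWP' : IsPeriodicCfg W ((tower L N (j + 1) : ℕ) : ℤ) := by rw [htow]; exact hWP
  have huP' : ∀ (z : Site d) (i : Fin d), u (z + ((tower L N (j + 1) : ℕ) : ℤ) • e i) = u z := by rw [htow]; exact huP
  -- the corner values
  have hcorner : ∀ z : Site d, ‖u (((M : ℕ) : ℤ) • z)‖ ≤ frameC d L * (L : ℝ) ^ (j + 1) * G := by
    intro z
    have h1 := framePotW_gaugeDir (M := N) hL1 j hWu hWP' hx hs hWx hus huP' z
    rw [hmean] at h1
    have h2 : u (((M : ℕ) : ℤ) • z) = framePotW L (j + 1) W (gaugeDir W u) z := by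
      rw [hMz, h1]; simp
    rw [h2]
    exact norm_framePotW_le_of_sup hL j hWu hx hs hWx (gaugeDir W u) hG0 hG z
  -- a general site: corner plus a covariant path inside the block
  have hy : ((M : ℕ) : ℤ) • cdiv M y + cmod M y = y := smul_cdiv_add_cmod M y
  have hpath := abs_norm_sub_norm_le hWu u hG (((M : ℕ) : ℤ) • cdiv M y) (cmod M y)
  rw [hy] at hpath
  have hsum : ∑ i, ((|cmod M y i| : ℤ) : ℝ) ≤ (d : ℝ) * M := by
    calc ∑ i, ((|cmod M y i| : ℤ) : ℝ) ≤ ∑ _i : Fin d, (M : ℝ) := Finset.sum_le_sum fun i _ => by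
            have h1 := cmod_nonneg hM y i
            have h2 := cmod_lt hM y i
            have h3 : |cmod M y i| ≤ (M : ℤ) := by rw [abs_le]; constructor <;> omega
            exact_mod_cast h3
      _ = (d : ℝ) * M := by simp
  have h1 := (abs_le.mp hpath).2
  calc ‖u y‖ ≤ ‖u (((M : ℕ) : ℤ) • cdiv M y)‖ + G * ∑ i, ((|cmod M y i| : ℤ) : ℝ) := by linarith
    _ ≤ frameC d L * (L : ℝ) ^ (j + 1) * G + G * ((d : ℝ) * M) := add_le_add (hcorner _) (mul_le_mul_of_nonneg_left hsum hG0)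
    _ = (frameC d L + d) * (L : ℝ) ^ (j + 1) * G := by rw [hMr]; ring

/-! ## §2 (H0_W) in the class from the local-gauge shape -/

/-- **(H0_W) IN THE MULTI-LEVEL SMALL-FIELD CLASS FROM THE LOCAL-GAUGE SHAPE** (`d ≥ 1`, `L ≥ 2`, `N ≥ 1`, level `j`, `M = L^{j+1}`, unitary `(N·M)`-periodic `W` with
`LevelSmall d L j x`, `SmallField W x`): for `u ∈ avgKernelGauges L N (j+1) W` with `‖Δ_Wu‖_∞ ≤ B`, the local-gauge SHAPE at radius `R` with constants `(a, δ)` and the line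
`2d·C_U∕R + (4Rδ + 24Rda² + 2a)·C_U + 8Rda ≤ ½`, `C_U = (frameC d L + d)·M`, give `‖D_Wu‖_∞ ≤ 4R·B` and `‖u‖_∞ ≤ 4C_U·R·B` (file 1 with §1). [folklore] -/
theorem supRegularity_of_localGauge_class [Nonempty n] (hd : 1 ≤ d) {L N : ℕ} [NeZero N] (hL : 2 ≤ L) (j : ℕ)
    {W : Site d → Fin d → (Matrix n n ℂ)ˣ} {x : ℝ} (hWu : IsUnitaryCfg W) (hWP : IsPeriodicCfg W ((N * L ^ (j + 1) : ℕ) : ℤ))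
    (hx : 0 ≤ x) (hs : LevelSmall d L j x) (hWx : SmallField W x)
    {u : Site d → (Matrix n n ℂ)} (hu : u ∈ avgKernelGauges (d := d) (n := n) L N (j + 1) W) {B : ℝ} (hB : ∀ y : Site d, ‖covLapSite W u y‖ ≤ B)
    {R : ℕ} (hR : 1 ≤ R) {a δ : ℝ} (ha0 : 0 ≤ a)
    (hgauge : ∀ (y₀ : Site d) (μ₀ : Fin d), ∃ g : Site d → (Matrix n n ℂ)ˣ, (∀ z, g z ∈ unitaryUnits (Matrix n n ℂ)) ∧
      (∀ (z : Site d) (ν : Fin d), (∀ i, |z i - y₀ i| ≤ (R : ℤ) + 1) → ‖((gaugeAct g W z ν : (Matrix n n ℂ)ˣ) : Matrix n n ℂ) - 1‖ ≤ a) ∧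
      (∀ z : Site d, (∀ i, |z i - y₀ i| ≤ (R : ℤ)) →
        ‖∑ ν : Fin d, ((((gaugeAct g W z ν : (Matrix n n ℂ)ˣ) : Matrix n n ℂ) - 1) - (((gaugeAct g W (z - e ν) ν : (Matrix n n ℂ)ˣ) : Matrix n n ℂ) - 1))‖ ≤ δ))
    (hline : 2 * (d : ℝ) * ((frameC d L + d) * (L : ℝ) ^ (j + 1)) / R
        + (4 * R * δ + 24 * R * d * a ^ 2 + 2 * a) * ((frameC d L + d) * (L : ℝ) ^ (j + 1)) + 8 * R * d * a ≤ 1 / 2) :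
    (∀ (y : Site d) (μ : Fin d), ‖gaugeDir W u y μ‖ ≤ 4 * R * B) ∧
      (∀ y : Site d, ‖u y‖ ≤ 4 * ((frameC d L + d) * (L : ℝ) ^ (j + 1)) * R * B) := by
  have hL1 : 1 ≤ L := by omega
  have hN : 1 ≤ N := Nat.one_le_iff_ne_zero.mpr (NeZero.ne N)
  have hP : 1 ≤ N * L ^ (j + 1) := Nat.mul_pos (by omega) (Nat.one_le_pow _ _ hL1)
  have hCU : 0 ≤ (frameC d L + d) * (L : ℝ) ^ (j + 1) := by
    have : 0 ≤ frameC d L := by unfold frameC; positivity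
    positivity
  exact supRegularity_of_localGauge hd hP hWu hWP hu.2.1 hR ha0 hCU hB
    (fun s hs' y => norm_le_of_mem_avgKernelGauges hd hL j hWu hWP hx hs hWx hu hs' y) hgauge hline

/-! ## §3 THE END's `hK` at a curved background of the class from the local-gauge shape and (HR_W) -/

/-- **`hK` AT A CURVED BACKGROUND FROM LOCAL GAUGES AND (HR_W)** (`d ≥ 1`, `L ≥ 2`, `N ≥ 1`, `j`; `M = L^{j+1}`, `θ = cruxC·M²x < 1`): gen 7's
`landauCorrectionSupB8_of_supFacts` with its (H0_W) binder supplied by §2 (`c₀ = 4(frameC d L + d)·R∕M`, `c₁ = 4R∕M`): `LandauCorrectionSupB8 hL j hWu hx hs hWx N hθ K₀ K₁` ⇐ the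
local-gauge SHAPE at radius `R` ∧ the line ∧ (HR_W) (the `ℓ^∞` bound of B8's projection `R(W)`, [Balaban1985BackgroundPropagators] (3.25)∕(3.49) TYPE). [folklore] -/
theorem landauCorrectionSupB8_of_localGauge [Nonempty n] (hd : 1 ≤ d) {L : ℕ} (hL : 2 ≤ L) (j : ℕ)
    {W : Site d → Fin d → (Matrix n n ℂ)ˣ} {x : ℝ} (hWu : IsUnitaryCfg W) (hx : 0 ≤ x) (hs : LevelSmall d L j x) (hWx : SmallField W x)
    (N : ℕ) [NeZero N] (hθ : cruxC d L * (((L : ℝ) ^ (j + 1)) ^ 2 * x) < 1) (hWP : IsPeriodicCfg W ((N * L ^ (j + 1) : ℕ) : ℤ))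
    {R : ℕ} (hR : 1 ≤ R) {a δ cR : ℝ} (ha0 : 0 ≤ a)
    (hgauge : ∀ (y₀ : Site d) (μ₀ : Fin d), ∃ g : Site d → (Matrix n n ℂ)ˣ, (∀ z, g z ∈ unitaryUnits (Matrix n n ℂ)) ∧
      (∀ (z : Site d) (ν : Fin d), (∀ i, |z i - y₀ i| ≤ (R : ℤ) + 1) → ‖((gaugeAct g W z ν : (Matrix n n ℂ)ˣ) : Matrix n n ℂ) - 1‖ ≤ a) ∧
      (∀ z : Site d, (∀ i, |z i - y₀ i| ≤ (R : ℤ)) →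
        ‖∑ ν : Fin d, ((((gaugeAct g W z ν : (Matrix n n ℂ)ˣ) : Matrix n n ℂ) - 1) - (((gaugeAct g W (z - e ν) ν : (Matrix n n ℂ)ˣ) : Matrix n n ℂ) - 1))‖ ≤ δ))
    (hline : 2 * (d : ℝ) * ((frameC d L + d) * (L : ℝ) ^ (j + 1)) / R
        + (4 * R * δ + 24 * R * d * a ^ 2 + 2 * a) * ((frameC d L + d) * (L : ℝ) ^ (j + 1)) + 8 * R * d * a ≤ 1 / 2)
    (hRW : ∀ (F : Site d → (Matrix n n ℂ)), (∀ y : Site d, F y ∈ skewAdjoint (Matrix n n ℂ)) →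
      (∀ (y : Site d) (i : Fin d), F (y + ((N * L ^ (j + 1) : ℕ) : ℤ) • e i) = F y) →
      ∀ μ ∈ avgKernelGauges (d := d) (n := n) L N (j + 1) W,
        (∀ ν ∈ avgKernelGauges (d := d) (n := n) L N (j + 1) W,
          ∑ y ∈ periodBox (d := d) (N * L ^ (j + 1)), hsR (F y + covLapSite W μ y) (covLapSite W ν y) = 0) →
        ∀ B : ℝ, (∀ y : Site d, ‖F y‖ ≤ B) → ∀ y : Site d, ‖covLapSite W μ y‖ ≤ cR * B) :
    LandauCorrectionSupB8 hL j hWu hx hs hWx N hθ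
      ((d : ℝ) * liftC d * (6 + 2 * ((d : ℝ) + 1) * (((L : ℝ) ^ (j + 1)) ^ 2 * x)) * (4 * (frameC d L + d) * R / (L : ℝ) ^ (j + 1)) * cR
        / (1 - cruxC d L * (((L : ℝ) ^ (j + 1)) ^ 2 * x)))
      ((d : ℝ) * liftC d * (6 + 2 * ((d : ℝ) + 1) * (((L : ℝ) ^ (j + 1)) ^ 2 * x)) * (4 * R / (L : ℝ) ^ (j + 1)) * cR
        / (1 - cruxC d L * (((L : ℝ) ^ (j + 1)) ^ 2 * x))) := by
  have hM0 : (0 : ℝ) < (L : ℝ) ^ (j + 1) := by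
    have : (0 : ℝ) < L := by exact_mod_cast (by omega : 0 < L)
    positivity
  refine landauCorrectionSupB8_of_supFacts hL j hWu hx hs hWx N hθ hWP (fun u hu B hB => ?_) hRW
  obtain ⟨hD, hU⟩ := supRegularity_of_localGauge_class hd hL j hWu hWP hx hs hWx hu hB hR ha0 hgauge hline
  refine ⟨fun y => (hU y).trans (le_of_eq ?_), fun y μ => (hD y μ).trans (le_of_eq ?_)⟩
  · field_simp
  · field_simp

/-! ## §4 The `a`-half of the local-gauge shape from the axial gauge: (H0_W) from the axial-gauge divergence alone -/

/-- In the axial gauge based at `y₀ − (R+1)𝟙` every bond variable on the sup-cube of radius `R + 1` about `y₀` is within `2d(R+1)·x` of `1`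
(`axial_bond_bound_sharp` + the `ℓ¹` size of the cube). [folklore] -/
theorem norm_axial_sub_one_le_cube [Nonempty n] {W : Site d → Fin d → (Matrix n n ℂ)ˣ} {x : ℝ} (hWu : IsUnitaryCfg W) (hx : 0 ≤ x) (hWx : SmallField W x)
    (y₀ : Site d) (R : ℕ) (z : Site d) (ν : Fin d) (hz : ∀ i, |z i - y₀ i| ≤ (R : ℤ) + 1) :
    ‖((gaugeAct (axialFn W (y₀ - fun _ => (R : ℤ) + 1)) W z ν : (Matrix n n ℂ)ˣ) : Matrix n n ℂ) - 1‖ ≤ 2 * (d : ℝ) * (R + 1) * x := by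
  set yb : Site d := y₀ - fun _ => (R : ℤ) + 1 with hyb
  have hU1 : ∀ x' κ, W x' κ ∈ U1 (Matrix n n ℂ) := fun x' κ => mem_U1_of_unitary (hWu x' κ)
  have hP : PlaqSmall W yb (z + e ν) x := fun x' κ₁ κ₂ hne _ _ => hWx x' κ₁ κ₂ hne
  have hyz : yb ≤ z := by
    intro i
    have h1 := (abs_le.mp (hz i)).1
    show y₀ i - ((R : ℤ) + 1) ≤ z i
    linarith
  have h := axial_bond_bound_sharp W hU1 hP yb z ν le_rfl hyz le_rfl
  refine h.trans ?_
  have h3 : l1 (lowPart ν (z - yb)) ≤ l1 (z - yb) := l1_lowPart_le ν _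
  have h4 : l1 (z - yb) ≤ d * (2 * R + 2) := by
    unfold l1
    calc ∑ i, ((z - yb) i).natAbs ≤ ∑ _i : Fin d, (2 * R + 2) := Finset.sum_le_sum fun i _ => by
            have h1 := abs_le.mp (hz i)
            have e1 : (z - yb) i = z i - y₀ i + ((R : ℤ) + 1) := by rw [hyb]; simp; ring
            rw [e1]; omega
      _ = d * (2 * R + 2) := by simp
  have h5 : (l1 (lowPart ν (z - yb)) : ℝ) ≤ 2 * (d : ℝ) * (R + 1) := by
    have := h3.trans h4
    have h6 : ((l1 (lowPart ν (z - yb)) : ℕ) : ℝ) ≤ ((d * (2 * R + 2) : ℕ) : ℝ) := by exact_mod_cast this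
    refine h6.trans (le_of_eq ?_); push_cast; ring
  exact mul_le_mul_of_nonneg_right h5 hx

/-- **(H0_W) IN THE CLASS FROM THE AXIAL-GAUGE DIVERGENCE ALONE**: the local-gauge shape of §2 with the axial gauge (`a = 2d(R+1)·x` by `norm_axial_sub_one_le_cube`), so
the ONLY displayed input about `W` is the divergence bound `‖Σ_ν(E(y,ν) − E(y−e_ν,ν))‖ ≤ δ` of `E = W^{axialFn W (y₀ − (R+1)𝟙)} − 1` on every sup-cube of radius `R` —
census R39 brick (i): in the class with flux-gradient regularity `x₁` it holds with `δ ≍ dR·x₁ + R²x²` (NOT proved here). [folklore] -/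
theorem supRegularity_of_axialDivergence [Nonempty n] (hd : 1 ≤ d) {L N : ℕ} [NeZero N] (hL : 2 ≤ L) (j : ℕ)
    {W : Site d → Fin d → (Matrix n n ℂ)ˣ} {x : ℝ} (hWu : IsUnitaryCfg W) (hWP : IsPeriodicCfg W ((N * L ^ (j + 1) : ℕ) : ℤ))
    (hx : 0 ≤ x) (hs : LevelSmall d L j x) (hWx : SmallField W x)
    {u : Site d → (Matrix n n ℂ)} (hu : u ∈ avgKernelGauges (d := d) (n := n) L N (j + 1) W) {B : ℝ} (hB : ∀ y : Site d, ‖covLapSite W u y‖ ≤ B)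
    {R : ℕ} (hR : 1 ≤ R) {δ : ℝ}
    (hdiv : ∀ (y₀ y : Site d), (∀ i, |y i - y₀ i| ≤ (R : ℤ)) →
      ‖∑ ν : Fin d, ((((gaugeAct (axialFn W (y₀ - fun _ => (R : ℤ) + 1)) W y ν : (Matrix n n ℂ)ˣ) : Matrix n n ℂ) - 1)
        - (((gaugeAct (axialFn W (y₀ - fun _ => (R : ℤ) + 1)) W (y - e ν) ν : (Matrix n n ℂ)ˣ) : Matrix n n ℂ) - 1))‖ ≤ δ)
    (hline : 2 * (d : ℝ) * ((frameC d L + d) * (L : ℝ) ^ (j + 1)) / R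
        + (4 * R * δ + 24 * R * d * (2 * (d : ℝ) * (R + 1) * x) ^ 2 + 2 * (2 * (d : ℝ) * (R + 1) * x)) * ((frameC d L + d) * (L : ℝ) ^ (j + 1))
        + 8 * R * d * (2 * (d : ℝ) * (R + 1) * x) ≤ 1 / 2) :
    (∀ (y : Site d) (μ : Fin d), ‖gaugeDir W u y μ‖ ≤ 4 * R * B) ∧
      (∀ y : Site d, ‖u y‖ ≤ 4 * ((frameC d L + d) * (L : ℝ) ^ (j + 1)) * R * B) :=
  supRegularity_of_localGauge_class hd hL j hWu hWP hx hs hWx hu hB hR (by positivity)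
    (fun y₀ _ => ⟨axialFn W (y₀ - fun _ => (R : ℤ) + 1), fun z => hol_mem_of (S := unitaryUnits (Matrix n n ℂ)) hWu _ _,
      fun z ν hz => norm_axial_sub_one_le_cube hWu hx hWx y₀ R z ν hz, fun z hz => hdiv y₀ z hz⟩) hline

/-- **THE END's `hK` AT A CURVED BACKGROUND FROM THE AXIAL-GAUGE DIVERGENCE AND (HR_W)**: §3 with the axial gauge of §4. [folklore] -/
theorem landauCorrectionSupB8_of_axialDivergence [Nonempty n] (hd : 1 ≤ d) {L : ℕ} (hL : 2 ≤ L) (j : ℕ)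
    {W : Site d → Fin d → (Matrix n n ℂ)ˣ} {x : ℝ} (hWu : IsUnitaryCfg W) (hx : 0 ≤ x) (hs : LevelSmall d L j x) (hWx : SmallField W x)
    (N : ℕ) [NeZero N] (hθ : cruxC d L * (((L : ℝ) ^ (j + 1)) ^ 2 * x) < 1) (hWP : IsPeriodicCfg W ((N * L ^ (j + 1) : ℕ) : ℤ))
    {R : ℕ} (hR : 1 ≤ R) {δ cR : ℝ}
    (hdiv : ∀ (y₀ y : Site d), (∀ i, |y i - y₀ i| ≤ (R : ℤ)) →
      ‖∑ ν : Fin d, ((((gaugeAct (axialFn W (y₀ - fun _ => (R : ℤ) + 1)) W y ν : (Matrix n n ℂ)ˣ) : Matrix n n ℂ) - 1)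
        - (((gaugeAct (axialFn W (y₀ - fun _ => (R : ℤ) + 1)) W (y - e ν) ν : (Matrix n n ℂ)ˣ) : Matrix n n ℂ) - 1))‖ ≤ δ)
    (hline : 2 * (d : ℝ) * ((frameC d L + d) * (L : ℝ) ^ (j + 1)) / R
        + (4 * R * δ + 24 * R * d * (2 * (d : ℝ) * (R + 1) * x) ^ 2 + 2 * (2 * (d : ℝ) * (R + 1) * x)) * ((frameC d L + d) * (L : ℝ) ^ (j + 1))
        + 8 * R * d * (2 * (d : ℝ) * (R + 1) * x) ≤ 1 / 2)
    (hRW : ∀ (F : Site d → (Matrix n n ℂ)), (∀ y : Site d, F y ∈ skewAdjoint (Matrix n n ℂ)) →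
      (∀ (y : Site d) (i : Fin d), F (y + ((N * L ^ (j + 1) : ℕ) : ℤ) • e i) = F y) →
      ∀ μ ∈ avgKernelGauges (d := d) (n := n) L N (j + 1) W,
        (∀ ν ∈ avgKernelGauges (d := d) (n := n) L N (j + 1) W,
          ∑ y ∈ periodBox (d := d) (N * L ^ (j + 1)), hsR (F y + covLapSite W μ y) (covLapSite W ν y) = 0) →
        ∀ B : ℝ, (∀ y : Site d, ‖F y‖ ≤ B) → ∀ y : Site d, ‖covLapSite W μ y‖ ≤ cR * B) :
    LandauCorrectionSupB8 hL j hWu hx hs hWx N hθ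
      ((d : ℝ) * liftC d * (6 + 2 * ((d : ℝ) + 1) * (((L : ℝ) ^ (j + 1)) ^ 2 * x)) * (4 * (frameC d L + d) * R / (L : ℝ) ^ (j + 1)) * cR
        / (1 - cruxC d L * (((L : ℝ) ^ (j + 1)) ^ 2 * x)))
      ((d : ℝ) * liftC d * (6 + 2 * ((d : ℝ) + 1) * (((L : ℝ) ^ (j + 1)) ^ 2 * x)) * (4 * R / (L : ℝ) ^ (j + 1)) * cR
        / (1 - cruxC d L * (((L : ℝ) ^ (j + 1)) ^ 2 * x))) :=
  landauCorrectionSupB8_of_localGauge hd hL j hWu hx hs hWx N hθ hWP hR (a := 2 * (d : ℝ) * (R + 1) * x) (by positivity)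
    (fun y₀ _ => ⟨axialFn W (y₀ - fun _ => (R : ℤ) + 1), fun z => hol_mem_of (S := unitaryUnits (Matrix n n ℂ)) hWu _ _,
      fun z ν hz => norm_axial_sub_one_le_cube hWu hx hWx y₀ R z ν hz, fun z hz => hdiv y₀ z hz⟩) hline hRW

end

end Summit.QuantumFields.BalabanUV.T4Continuum.NE3.LandauCorrectionSupB8LocalGauge
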